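import Literature.Analysis.PDE.LinearWaveFrameRecovery
import HarnessLib

/-!
# Linear scalar wave equations in frame variables, III: recovery of the second-order equation
# with a source term

Analysis/PDE support file (everything proved) continuing `LinearWaveFrameRecovery.lean`
(`WaveFrame.eventually_P_eq_zero_of_rows`: a smooth solution `(f, ϖ, ψ)` of the three rows of
John's symmetric first-order form of `P f = 0`, with the constraint `ψ_l = e_lᵏ f_k` at `t = 0`,
satisfies the constraint and `P f = 0` near the base point). Here the `ϖ`-row carries an additional
**source** `(√a)⁻¹ s` — as it does for each component of a *diagonal second-order system*
`P f_K = −(coupling of the other components)`, the coupling being, for a given solution of the big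
first-order system, a known smooth function `s` of the point: then near the base point the
constraint persists and **`P f = −s`** (`WaveFrame.eventually_P_eq_of_rows_source`). The
constraint propagation (`WaveFrame.D0_defect`, `WaveFrame.transport_eventually_eq_zero`) does not
involve the `ϖ`-row; the last step is the pointwise identity `WaveFrame.P_eq` (John 1982, Ch. 5 §3).

## References

* F. John, *Partial differential equations*, 4th ed., Springer 1982, Ch. 5 §3. [John1982]
* S. Alinhac, *Hyperbolic Partial Differential Equations*, Springer 2009, §7.6 Ex. 7.5. [Alinhac2009]
-/

noncomputable section

open Set Filter
open scoped Topology ContDiff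

namespace Literature.Analysis.PDE

namespace WaveFrame

open VarWave

variable {n : ℕ} {a : Pt n → ℝ} {β : Fin n → Pt n → ℝ} {Q h e : Fin n → Fin n → Pt n → ℝ}
  {bT c : Pt n → ℝ} {bX : Fin n → Pt n → ℝ}

/-- **Recovery with a source.** Let `(f, ϖ, ψ)` be a smooth solution of the `f`- and `ψ`-rows of
the first-order system and of the `ϖ`-row with an additional source `(√a)⁻¹ s`, with
`ψ_l = e_lᵏ f_k` at `t = 0` near `x₁`. Then near `(0, x₁)` the constraint persists and `f` solves
the second-order equation `P f = −s`. [cite: John1982, Ch. 5 §3] -/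
theorem eventually_P_eq_of_rows_source (ha : ContDiff ℝ ∞ a) (hapos : ∀ q, 0 < a q)
    (hβ : ∀ j, ContDiff ℝ ∞ (β j)) (hh : ∀ j k, ContDiff ℝ ∞ (h j k))
    (he : ∀ l k, ContDiff ℝ ∞ (e l k)) (hQ : ∀ j k q, ∑ l, e l j q * e l k q = Q j k q)
    (hinv : ∀ k i q, ∑ j, h k j q * Q j i q = if k = i then 1 else 0)
    {f ϖ : Pt n → ℝ} {ψ : Fin n → Pt n → ℝ} {s : Pt n → ℝ} (hf : ContDiff ℝ ∞ f)
    (hψ : ∀ l, ContDiff ℝ ∞ (ψ l))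
    (Rf : ∀ q, D0 β f q = (Real.sqrt (a q))⁻¹ * ϖ q)
    (Rψ : ∀ q l, D0 β (ψ l) q = rowPsi a β h e ϖ ψ l q)
    (Rπ : ∀ q, D0 β ϖ q = rowPi a β h e bT bX c f ϖ ψ q + (Real.sqrt (a q))⁻¹ * s q)
    {x₁ : EuclideanSpace ℝ (Fin n)} (hcons : ∀ᶠ y in 𝓝 x₁, ∀ l, ψ l (0, y) = psiF e f l (0, y)) :
    ∀ᶠ p in 𝓝 ((0 : ℝ), x₁), (∀ l, ψ l p = psiF e f l p) ∧ P a β Q bT bX c f p = -s p := by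
  have hpi := piT_eq_of_row hapos Rf
  have hSne : ∀ q, Real.sqrt (a q) ≠ 0 := fun q ↦ (Real.sqrt_pos.2 (hapos q)).ne'
  -- the defects solve a smooth transport system with zero data
  set C : Fin n → Pt n → ℝ := fun l r ↦ ψ l r - psiF e f l r with hCdef
  have hCs : ∀ l, ContDiff ℝ ∞ (C l) := fun l ↦ (hψ l).sub (contDiff_psiF he hf l)
  have hetil : ∀ m k, ContDiff ℝ ∞ (etil h e m k) := fun m k ↦
    ContDiff.sum fun j _ ↦ (hh k j).mul (he m j)
  have hMc : ∀ l m, Continuous (Mco β h e l m) := fun l m ↦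
    ((continuous_finsetSum _ fun k _ ↦ (contDiff_D0 hβ (he l k)).continuous.mul
      (hetil m k).continuous).add
      (continuous_finsetSum _ fun k _ ↦ (he l k).continuous.mul
        (continuous_finsetSum _ fun j _ ↦ (contDiff_dX (hβ j) k).continuous.mul
          (hetil m j).continuous)))
  have heq : ∀ p l, dT (C l) p = ∑ j, β j p * dX (C l) j p + ∑ m, Mco β h e l m p * C m p := by
    intro p l
    have hD := D0_defect ha hapos hβ he hQ hinv hf hψ Rf Rψ l p
    unfold D0 at hD
    simp only [hCdef]
    linarith
  have h0 : ∀ᶠ y in 𝓝 x₁, ∀ l, C l (0, y) = 0 := by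
    filter_upwards [hcons] with y hy l
    simp only [hCdef, hy l, sub_self]
  have hzero := transport_eventually_eq_zero hβ hMc hCs heq h0
  -- an open set on which the constraint holds
  obtain ⟨O, hOsub, hOo, hOmem⟩ := _root_.eventually_nhds_iff.1 hzero
  have hψeq : ∀ p ∈ O, ∀ l, ψ l p = psiF e f l p := fun p hp l ↦ by
    have := hOsub p hp l
    simp only [hCdef] at this
    linarith
  filter_upwards [hOo.mem_nhds hOmem] with p hp
  refine ⟨hψeq p hp, ?_⟩
  -- substitute the rows into the frame form of `P f`
  have hdXψ : ∀ l j, dX (psiF e f l) j p = dX (ψ l) j p := fun l j ↦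
    (dX_congr hOo (fun q hq ↦ (hψeq q hq l)) j hp).symm
  have hF : ∀ k, Fv h e ψ k p = dX f k p := fun k ↦ by
    rw [Fv_congr (fun m ↦ hψeq p hp m) k, Fv_psiF hQ hinv]
  have hdT : dT f p = (Real.sqrt (a p))⁻¹ * ϖ p + ∑ j, β j p * dX f j p := by
    have := Rf p
    unfold D0 at this
    linarith
  rw [P_eq ha hapos hβ he hQ hf p, hpi, Rπ p, mul_add, ← mul_assoc, mul_inv_cancel₀ (hSne p), one_mul]
  unfold rowPi
  rw [mul_inv_cancel_left₀ (hSne p)]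
  unfold bracketPi
  simp only [hF, hdXψ, Rf p, hdT]
  ring

end WaveFrame

end Literature.Analysis.PDE

end
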